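import Summits.ResolutionOfSingularities.ResolutionOfSingularities.Theorems.MarkedTransferCampaignG1PnegaObligationF3hs
import Summits.ResolutionOfSingularities.ResolutionOfSingularities.Theorems.MarkedTransferCampaignW12SandwichRho
import Summits.ResolutionOfSingularities.ResolutionOfSingularities.Theorems.MarkedTransferCampaignG1PnegaPowerWitness
import Literature.AlgebraicGeometry.Resolution.HasseSchmidtFrobeniusCongruence
import HarnessLib

/-!
# [OURS · L1 G1 ℘nega-INTERFACE · cell K13-2] The BOUNDED Hasse–Schmidt cell **F3hs^{<p^e}** (`F3hsBddAt`) and its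
# decision on the Frobenius-sandwich carriers SWρ (`Campaign.sandwichPTildeNegRho`, p488714) and SW
# (`Campaign.sandwichPTildeNeg`) — PART A: ✓ SUMMAND-WISE (ρ^e-linearity, every ring of characteristic `p`, every HS system);
# Part B (sibling `…F3hsBddWitness.lean`) = ✗ FOR THE GUARDED FAMILY of Def. 5.1 shape (boundary summand `d·m = a`; class regime
# `m = p^e`, every `e ≥ 1`, at both placements of record). Kernel by res-D-pv-031 (res-D-plan-1 ROUTING #13 (a) K13-2 2026-08-27T03:16:00Z, dealt
# 03:30:27Z); draft for the carrier res-L1-type-o2 (sibling of `…G1PnegaObligationF3hs.lean` p490404/p490787, the file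
# of the UNBOUNDED predicate `PnegaObligation.F3hsAt`; suggested split if > 400 lines: Part A = §1–§3 + §6, Part B = §4–§5).

WHAT K13-2 ASKS (res-D-plan-1 ROUTING #13 (a), verbatim up to notation): the data-level predicate
`F3hsBddAt p e T tildeP := ∀ β, 0 < |β| → |β| < p^e → ∀ i < 0, ∀ f ∈ tildeP i, hsComponent T β f ∈ tildeP (i − |β|)`
(the Hasse–Schmidt cell F3hs of record, `PnegaObligation.F3hsAt`, RESTRICTED to orders below `p^e`) — «the one
Diff-stability a non-`O`-stable candidate can meet» — DECIDED on the SWρ carrier at the sandwich placement; res-adj-1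
2026-08-27T03:04:37Z (4) predicted «✓c via ρ^e-linearity of HS components of order `< p^e`»; the unbounded F3hs reads ✗ for
the same tails by the Frobenius rule at order `p^N` (`F3hsAt.one_mem_of_pow_mem`).

WHAT IS DECIDED HERE (kernel, sorry-free; a SCORED-CELL record, not a verdict on any printed statement).
* §2 **ρ^e-LINEARITY AND ORDER, general.** For EVERY commutative ring `O` of characteristic `p`, EVERY ring homomorphism
  `T : O → O⟦t_σ⟧` with `D^{[0]} = id` and every `β` with `|β| < p^e`: `D^{[β]}(c^{p^e}·x) = c^{p^e}·D^{[β]} x`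
  (`hsComponent_pow_pow_mul` — Leibniz + `Resolution.hsComponent_pow_expChar_pow_eq_zero_of_not_dvd`: a non-zero `β' ≤ β`
  has a coordinate in `(0, p^e)`), so `D^{[β]}` is a `ρ^e(O)`-LINEAR endomorphism (`hsComponentRhoₗ`) and a differential
  operator of order `≤ |β|` RELATIVE TO `ρ^e(O)` (`isDiffOpLE_hsComponentRhoₗ`, the EGA IV₄ 16.11.2 induction run at base
  `ρ^e(O)` — the commutator `[D^{[β]}, a]` is a combination of components of smaller degree, `commMul_hsComponentRhoₗ`).
  COROLLARY (`F3hsBddAt_of_subset_range_pow`): a family whose negative pieces consist of `p^e`-th powers (F6d-elt at exponent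
  `e`, data level) meets F3hs^{<p^e} for EVERY HS system, content-free (the components of order in `(0, p^e)` kill it) — so
  the bounded column is IMPLIED BY F6d-elt and discriminates only among F6d-failing candidates (SW / SWρ); K13-3's PW reads ✓
  (`F3hsBddAt_powerWitness`, agreeing with res-type-087's `PowerWitness.hsComponent_mem_negPiece_of_degree_lt`).
* §3 **✓ SUMMAND-WISE.** Hence for every summand of Eq. (36) re-based on `ρ^e(O)` (`Campaign.sandwichDDRho p e P m a d`,
  the `ρ^e(O)`-span of the values `∂f`, `ord_{ρ^e} ∂ ≤ dm + a`, `f ∈ ℘posi(E,dm)`), with `0 ≤ dm + a`: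
  `D^{[β]}(sandwichDDRho … a d) ⊆ sandwichDDRho … (a + |β|) d` (`hsComponent_mem_sandwichDDRho`: `D^{[β]} ∘ ∂` has
  order `≤ dm + a + |β|`, `IsDiffOpLE.comp`), and at family level `D^{[β]}(℘̃_swρ(E,−a))` lies in the sum of the summands
  `(a + |β|, d)` over the SAME index range `dm ≥ |a|` (`hsComponent_mem_iSup_sandwichDDRho`). This is the content of
  res-adj-1's «✓c»: true at FIXED `d`.
* §4 **✗ FOR THE GUARDED FAMILY.** Def. 5.1's range `dm ≥ |a|` (Eq. (36) line 1, typed verbatim in row 008's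
  `S05NegativePart.pTildeNeg` and in `sandwichPTildeNegRho`) admits at degree `−(a+|β|)` only `d` with `dm ≥ a + |β|`, so the
  image of the BOUNDARY summand `dm = a` (more generally `a ≤ dm < a + |β|`) is not a summand of the target. Kernel witness,
  PARAMETRIC (`not_F3hsBddAt_sandwichRhoFamily`): any `O` of characteristic `p`, any HS homomorphism `T` with `D^{[0]} = id`
  and an element `y` with `D^{[e_j]} y = 1`, the `(y)`-adic placement `P n = (y^n)`, class regime `m = q := p^e`, `e ≥ 1`:
  `y^{q+1} ∈ ℘̃_swρ(E,−q)` (summand `d = 1`, `∂ = id`, `y^{q+1} ∈ ℘(E,q) = (y^q)`), and by §2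
  `D^{[e_j]}(y^q·y) = y^q·D^{[e_j]} y = y^q`; but at degree `−(q+1)` the guard forces `d ≥ 2`, every source `℘(E,dq) = (y^{dq})
  = ρ^e(y^d)·O` is a module of SANDWICH CONSTANTS, stable under every `ρ^e(O)`-linear map (`apply_mem_span_pow_mul_pow`), so
  `℘̃_swρ(E,−q−1) ⊆ (y^{2q}) ∌ y^q`. The same for the `O`-IDEAL sandwich SW (`not_F3hsBddAt_sandwichFamily`; SWρ ⊆ SW
  degree-wise, `sandwichRhoFamily_le_sandwichFamily`, and the ideal `Diff^{(·)}_{O/ρ^e}((y^{dq}))` stays inside `(y^{dq})`).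
* §5 **INSTANCES at the placements of record**, hypothesis-free: (a) the affine line `K[x] = MvPolynomial (Fin 1) K`,
  `char K = p`, `P a = (x)^a` (res-type-072's `PnegaObligation.AffineLine` datum / res-D-pv-040's calibration placement) for
  EVERY HS system with `D^{[1]} x = 1` (`not_F3hsBddAt_sandwichRhoFamily_affineLine`) and for the polynomial Taylor system
  `f ↦ f(x+t)` (`polyTaylorHS`, `…_affineLine_taylor`); (b) `K[x]_{(x)} = OriginLocalization K 1`, `P a = 𝔪^a`, with the
  TREE's Taylor system `Resolution.OriginLocalization.taylorHS K 1` (the HS system of K13-1 / `…G1PnegaOriginHsDatum.lean`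
  p492822): `not_F3hsBddAt_sandwichRhoFamily_originLocalization'`, `not_F3hsBddAt_sandwichFamily_originLocalization`.
* §6 On the checklist of record every inhabitant of `PnegaInterfaceV3` meets F3hs^{<p^e} (it meets F3hs:
  `PnegaInterfaceV3.f3hsAt`), so the bounded cell is FORCED ✓ on inhabitants and discriminates only data-level candidates.

PRIOR / PARALLEL RECORD (credited, not re-proved): res-D-pv-040 «sandwich calibration at 𝔸¹» (HOME draft sha16 b33f70783795740c,
2026-08-27T03:42:56Z, carried by o2) computes `℘nega_sw(E,−a) = (x)^{k·p^e}` on the affine line and has the set-level Hasse-DERIVATIVE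
witnesses `not_hasseDerivOne_stable_sandwich(_Rho)_affineLine` — the same boundary-summand mechanism, found independently there and
here (res-D-pv-031 OFFER 03:30:03Z «INDEX GUARD»). The present files are the TYPED cell (`F3hsBddAt`, Hasse–SCHMIDT components of an
arbitrary HS homomorphism), the positive summand-wise theorem, and the ✗ at both placements incl. the tree's `taylorHS`.

SUGGESTED CELL TEXT (res-D-pv-031, for the scorers res-adj-1 / res-plan-2; their word governs): «F3hs^{<p^e} × SWρ (and × SW):
✓ summand-wise by kernel (ρ^e-linearity + order `≤ |β|` of `D^{[β]}`, `|β| < p^e`, every char-`p` ring, every HS system —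
`hsComponent_mem_sandwichDDRho`) / ✗ for Def 5.1's guarded family by kernel (boundary summand `d·m = a`: `y^{p^e+1} ∈
piece(−p^e)`, `D^{[1]} y^{p^e+1} = y^{p^e} ∉ piece(−p^e−1) ⊆ (y^{2p^e})`; class regime `m = p^e`, every `e ≥ 1`, affine line and
`K[x]_{(x)}` with the tree's `taylorHS` — `not_F3hsBddAt_sandwichRhoFamily_originLocalization'`); forced ✓ on V3 inhabitants.»
VERDICT-FREE READING: the bounded Hasse–Schmidt cell separates the OPERATOR question (answered ✓: relative operators of order
`< p^e` respect the sandwich) from Def 5.1's INDEXATION (answered ✗: the guard `dm ≥ |a|` drops the boundary summand as the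
degree decreases, and relative operators never leave the Frobenius span `ρ^e(y^d)·O` to compensate — print's compensating
`d`-climb, Lem 5.6 / Rem 5.7, is exactly what they cannot do, cf. pv-040 `not_monotone_sandwichDD_affineLine`). Whether a
guard-relaxed SWρ (index range of the SOURCE degree, §3's `hsComponent_mem_iSup_sandwichDDRho`) is worth scoring is the
scorers' / res-D-plan-1's design call (it trades F8⁻/F6d behaviour for F3hs^{<p^e} ✓); nothing here proposes it.

CARRIER NOTE (res-L1-type-o2 g6): KERNEL by res-D-pv-031 (HOME drafts `D/res-D-pv-031/PnegaObligationF3hsBdd.partA.draft.lean` a3cdef81908c379a / `…partB…` ef5b7402473d511e, SPLIT READY 2026-08-27T04:14:44Z), carried VERBATIM as Part A = this file, Part B = `MarkedTransferCampaignG1PnegaObligationF3hsBddWitness.lean`; [OURS · L1 G1] replaces the role of: nothing printed — a scored CELL predicate + kernels; NOT a statement of the manuscript.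
HONEST FRAMING. Nothing here is a statement of H. Hironaka's manuscript *Resolution of singularities in positive
characteristics* (2017-03-23, [Hironaka2017], lit key `paper:url-3343fd9e678b`): Def. 5.1 / Eq. (36) (p.25 L31–L44) enters only
as the typed SHAPE (`S05NegativePart.DD` / `pTildeNeg`, row 008) that the OURS carriers SW / SWρ re-base on `ρ^e(O)`, a CANDIDATE
[claim: Hironaka2017, status: under-review]; `F3hsBddAt`, `sandwichRhoFamily`, `sandwichFamily`, `hsComponentRhoₗ`, `polyTaylorHS`
are OURS instrument / model data, asserted of no candidate for the manuscript's `℘nega`. The theorems are bookkeeping about typed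
statements; AI kernel work, weaker than expert review; nothing here is progress on resolution of singularities in positive
characteristic; no claim beyond the kernel.
-/

noncomputable section

set_option linter.dupNamespace false -- mandated namespace of this single-conjunct summit

namespace Summit.ResolutionOfSingularities.ResolutionOfSingularities.Theorems.Campaign.PnegaObligation

open Literature.AlgebraicGeometry.Resolution
open Literature.AlgebraicGeometry.Hironaka2017
open Finsupp

universe u v w

/-! ## §1 The predicate F3hs^{<p^e} (data level, bare family; ROUTING #13 (a) K13-2 verbatim) -/

section Predicate

variable {B : Type v} [CommRing B] {σ : Type w}

/-- **F3hs^{<p^e} at one `P`** (data level, bare family; res-D-plan-1 ROUTING #13 (a) K13-2 «`F3hsBddAt (e) T tildeP := ∀ β,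
0 < degree β → degree β < p^e → ∀ i < 0, … hsComponent T β f ∈ tildeP (i − degree β)`»): the Hasse–Schmidt cell
`PnegaObligation.F3hsAt` RESTRICTED to the components `D^{[β]} = hsComponent T β` of orders `0 < |β| < p^e` — for every
NEGATIVE degree `i` and every `f ∈ tildeP i`, `D^{[β]} f ∈ tildeP (i − |β|)`. OURS obligation shape (a scored cell of the
℘nega-INTERFACE), asserted of no candidate. [folklore] -/
def F3hsBddAt (p e : ℕ) (T : B →+* MvPowerSeries σ B) (tildeP : ℤ → AddSubgroup B) : Prop :=
  ∀ β : σ →₀ ℕ, 0 < degree β → degree β < p ^ e → ∀ i : ℤ, i < 0 → ∀ f : B, f ∈ tildeP i →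
    hsComponent T β f ∈ tildeP (i - degree β)

/-- **F3hs ⇒ F3hs^{<p^e}** (drop the order bound): the unbounded Hasse–Schmidt cell of record (`F3hsAt`, p490404 §1) implies
the bounded one for every `p, e`. In particular F3⁻ ⇒ F3hs ⇒ F3hs^{<p^e} (`F3hsAt_of_F3negAllAt`). [folklore] -/
theorem F3hsBddAt_of_F3hsAt (p e : ℕ) (T : B →+* MvPowerSeries σ B) (tildeP : ℤ → AddSubgroup B)
    (h : F3hsAt T tildeP) : F3hsBddAt p e T tildeP :=
  fun β hβ _ i hi f hf => h β hβ i hi f hf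

end Predicate

/-! ## §2 ρ^e-linearity and relative order of the HS components of order `< p^e` (every char-`p` ring, every HS homomorphism) -/

section RhoLinear

variable {O : Type v} [CommRing O] (p : ℕ) [Fact p.Prime] [CharP O p] {σ : Type w}

/-- **Components of order `0 < |β| < p^e` kill `p^e`-th powers**: `D^{[β]}(c^{p^e}) = 0` — some coordinate `β_s` lies in
`(0, p^e)`, hence is not a multiple of `p^e`, and `T(c^{p^e}) = T(c)^{p^e}` is supported on `p^e·ℕ^σ`
(`Resolution.hsComponent_pow_expChar_pow_eq_zero_of_not_dvd`). [cite: Matsumura1987, §27 (E_t is a ring homomorphism)] -/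
theorem hsComponent_pow_pow_eq_zero_of_degree_lt (T : O →+* MvPowerSeries σ O) (e : ℕ) {β : σ →₀ ℕ}
    (hβ0 : β ≠ 0) (hβ : degree β < p ^ e) (c : O) : hsComponent T β (c ^ p ^ e) = 0 := by
  apply hsComponent_pow_expChar_pow_eq_zero_of_not_dvd T p
  obtain ⟨s, hs⟩ : ∃ s, β s ≠ 0 := by
    by_contra h
    push Not at h
    exact hβ0 (Finsupp.ext h)
  refine ⟨s, fun hdvd => ?_⟩
  have hle : β s ≤ degree β := Finsupp.le_degree s β
  have := Nat.le_of_dvd (Nat.pos_of_ne_zero hs) hdvd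
  omega

/-- **ρ^e-LINEARITY of the Hasse–Schmidt components below `p^e`**: for every ring homomorphism `T : O → O⟦t_σ⟧` with
`D^{[0]} = id` and every `|β| < p^e`, `D^{[β]}(c^{p^e}·x) = c^{p^e}·D^{[β]} x` (Leibniz rule `hsComponent_mul`; every term with a
non-zero first index `β' ≤ β` vanishes by `hsComponent_pow_pow_eq_zero_of_degree_lt`). This is res-adj-1's «ρ^e-linearity of HS
components of order `< p^e`» (2026-08-27T03:04:37Z (4)) for an ARBITRARY Hasse–Schmidt system, not only box Hasse derivatives.
[cite: Matsumura1987, §27 (higher derivations)] -/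
theorem hsComponent_pow_pow_mul [DecidableEq σ] (T : O →+* MvPowerSeries σ O)
    (hT0 : ∀ b, MvPowerSeries.constantCoeff (T b) = b) (e : ℕ) {β : σ →₀ ℕ} (hβ : degree β < p ^ e)
    (c x : O) : hsComponent T β (c ^ p ^ e * x) = c ^ p ^ e * hsComponent T β x := by
  have h0 : ((0 : σ →₀ ℕ), β) ∈ Finset.antidiagonal β := by simp
  rw [hsComponent_mul, ← Finset.add_sum_erase _ _ h0, hsComponent_zero T hT0,
    Finset.sum_eq_zero (fun q hq => ?_), add_zero]
  obtain ⟨hne, hq⟩ := Finset.mem_erase.mp hq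
  rw [Finset.mem_antidiagonal] at hq
  have h1 : q.1 ≠ 0 := by
    intro h1
    apply hne
    rw [h1, zero_add] at hq
    exact Prod.ext h1 hq
  have hdeg : degree q.1 + degree q.2 = degree β := by rw [← map_add, hq]
  rw [hsComponent_pow_pow_eq_zero_of_degree_lt p T e h1 (by omega) c, zero_mul]

/-- [OURS · instrument plumbing] The component `D^{[β]}`, `|β| < p^e`, as a `ρ^e(O)`-LINEAR endomorphism of `O` (scalars = the
subring `(iterateFrobenius O p e).range` of `p^e`-th powers, the base of the sandwich carriers SW / SWρ); linearity is
`hsComponent_pow_pow_mul`. NOT a statement of the manuscript. [folklore] -/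
def hsComponentRhoₗ [DecidableEq σ] (T : O →+* MvPowerSeries σ O)
    (hT0 : ∀ b, MvPowerSeries.constantCoeff (T b) = b) (e : ℕ) (β : σ →₀ ℕ) (hβ : degree β < p ^ e) :
    O →ₗ[↥(iterateFrobenius O p e).range] O where
  toFun := hsComponent T β
  map_add' := hsComponent_add T β
  map_smul' r x := by
    obtain ⟨c, hc⟩ := RingHom.mem_range.mp r.2
    rw [Subring.smul_def, Subring.smul_def, smul_eq_mul, smul_eq_mul, RingHom.id_apply, ← hc,
      iterateFrobenius_def, hsComponent_pow_pow_mul p T hT0 e hβ]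

/-- The underlying function of `hsComponentRhoₗ` is `hsComponent T β`. [folklore] -/
@[simp] theorem hsComponentRhoₗ_apply [DecidableEq σ] (T : O →+* MvPowerSeries σ O)
    (hT0 : ∀ b, MvPowerSeries.constantCoeff (T b) = b) (e : ℕ) (β : σ →₀ ℕ) (hβ : degree β < p ^ e) (x : O) :
    hsComponentRhoₗ p T hT0 e β hβ x = hsComponent T β x :=
  rfl

/-- **`[D^{[β]}, a] = Σ_{γ+δ=β, γ≠0} D^{[γ]}(a) • D^{[δ]}`** over the base `ρ^e(O)` (Leibniz minus its `γ = 0` term; the sum runs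
over the attached antidiagonal so that each `D^{[δ]}`, `|δ| ≤ |β| < p^e`, carries its own linearity certificate).
[cite: EGAIV4, Prop. 16.8.8 (b)] -/
theorem commMul_hsComponentRhoₗ [DecidableEq σ] (T : O →+* MvPowerSeries σ O)
    (hT0 : ∀ b, MvPowerSeries.constantCoeff (T b) = b) (e : ℕ) (β : σ →₀ ℕ) (hβ : degree β < p ^ e) (a : O) :
    commMul (↥(iterateFrobenius O p e).range) (hsComponentRhoₗ p T hT0 e β hβ) a =
      ∑ q ∈ ((Finset.antidiagonal β).erase (0, β)).attach,
        hsComponent T q.1.1 a • hsComponentRhoₗ p T hT0 e q.1.2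
          (lt_of_le_of_lt (by
            have hq := (Finset.mem_erase.mp q.2).2
            rw [Finset.mem_antidiagonal] at hq
            have : degree q.1.1 + degree q.1.2 = degree β := by rw [← map_add, hq]
            omega) hβ) := by
  refine LinearMap.ext fun t => ?_
  have h0 : ((0 : σ →₀ ℕ), β) ∈ Finset.antidiagonal β := by simp
  rw [commMul_apply, hsComponentRhoₗ_apply, hsComponent_mul, ← Finset.add_sum_erase _ _ h0,
    LinearMap.sum_apply]
  simp only [hsComponent_zero T hT0, hsComponentRhoₗ_apply, LinearMap.smul_apply, smul_eq_mul]
  rw [Finset.sum_attach ((Finset.antidiagonal β).erase (0, β))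
    (fun q => hsComponent T q.1 a * hsComponent T q.2 t)]
  ring

/-- **`D^{[β]}` is a differential operator of order `≤ |β|` RELATIVE TO `ρ^e(O)`** for `|β| < p^e` (EGA IV₄ 16.11.2 by induction
on `|β|`: the commutator with a multiplication is a combination of components of strictly smaller degree, each again below
`p^e`). So `D^{[β]}` is an admissible SANDWICH OPERATOR of order `|β|` in the sense of `Campaign.sandwichDDRho` /
`S05NegativePart.DD` at base `ρ^e(O)`. [cite: EGAIV4, Thm. 16.11.2 (the D_q are differential operators of order ≤ |q|)] -/
theorem isDiffOpLE_hsComponentRhoₗ [DecidableEq σ] (T : O →+* MvPowerSeries σ O)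
    (hT0 : ∀ b, MvPowerSeries.constantCoeff (T b) = b) (e : ℕ) :
    ∀ (n : ℕ) (β : σ →₀ ℕ) (hβ : degree β < p ^ e), degree β ≤ n →
      IsDiffOpLE (↥(iterateFrobenius O p e).range) n (hsComponentRhoₗ p T hT0 e β hβ)
  | 0, β, hβ, hn => by
    have hβ0 : β = 0 := by
      rw [← degree_eq_zero_iff]; omega
    subst hβ0
    intro a
    refine LinearMap.ext fun t => ?_
    simp only [commMul_apply, hsComponentRhoₗ_apply, hsComponent_zero T hT0, LinearMap.zero_apply]
    ring
  | n + 1, β, hβ, hn => fun a => by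
    rw [commMul_hsComponentRhoₗ p T hT0 e β hβ]
    refine IsDiffOpLE.sum _ fun q _ => IsDiffOpLE.smul _ (isDiffOpLE_hsComponentRhoₗ T hT0 e n q.1.2 _ ?_)
    obtain ⟨hne, hq⟩ := Finset.mem_erase.mp q.2
    rw [Finset.mem_antidiagonal] at hq
    have h1 : q.1.1 ≠ 0 := by
      intro h1
      apply hne
      rw [h1, zero_add] at hq
      exact Prod.ext h1 hq
    have hdeg : degree q.1.1 + degree q.1.2 = degree β := by rw [← map_add, hq]
    have h1' : 1 ≤ degree q.1.1 := by
      rw [Nat.one_le_iff_ne_zero, Ne, degree_eq_zero_iff]; exact h1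
    omega

/-- **F6d-elt ⇒ F3hs^{<p^e}, for free.** If every NEGATIVE piece of a family consists of `p^e`-th powers (the element-wise norm
demand `PnegaInterfaceV3.NormDemand e` read at the data level: `tildeP i ⊆ {b^{p^e}}`, `i < 0`), then the family meets
F3hs^{<p^e} for EVERY Hasse–Schmidt homomorphism `T` (not even `D^{[0]} = id` is needed): each component of order
`0 < |β| < p^e` KILLS the piece (`hsComponent_pow_pow_eq_zero_of_degree_lt`) and `0 ∈ tildeP (i − |β|)`. So the bounded cell
is implied by F6d-elt at the same exponent `e` — in particular the escape-class candidate PW of K13-3 scores F3hs^{<p^e} ✓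
content-free, as res-type-087 recorded for PW itself (`PowerWitness.hsComponent_mem_negPiece_of_degree_lt`,
`…G1PnegaPowerWitness.lean` §5 rev 2); the typed-predicate instance is `F3hsBddAt_powerWitness` below. The column therefore
discriminates only among candidates FAILING F6d-elt (such as SW / SWρ, §4). Recorded for the scorers; not a ruling. [folklore] -/
theorem F3hsBddAt_of_subset_range_pow (T : O →+* MvPowerSeries σ O) (e : ℕ) (tildeP : ℤ → AddSubgroup O)
    (h : ∀ i : ℤ, i < 0 → (tildeP i : Set O) ⊆ Set.range fun b : O => b ^ p ^ e) :
    F3hsBddAt p e T tildeP := by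
  intro β hβ0 hβ i hi f hf
  obtain ⟨c, rfl⟩ := h i hi hf
  have hβne : β ≠ 0 := by
    intro h0
    rw [h0, map_zero] at hβ0
    exact lt_irrefl 0 hβ0
  rw [hsComponent_pow_pow_eq_zero_of_degree_lt p T e hβne hβ c]
  exact AddSubgroup.zero_mem _

/-- **PW meets F3hs^{<p^e} (typed predicate), for every HS system** — instance of `F3hsBddAt_of_subset_range_pow` at res-type-087's
K13-3 scoring object `Campaign.PowerWitness.tilde p e P m` (negative pieces `PW(−a) = ρ^e(℘nega_sw(E,−a)) ⊆ {p^e-th powers}`,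
`PowerWitness.tilde_neg_subset_range_pow`, p492701). Same content as 087's own `PowerWitness.hsComponent_mem_negPiece_of_degree_lt`,
here in the cell's typed shape so the scorers can cite one predicate for SWρ (✗, §4–§5) and PW (✓). [folklore] -/
theorem F3hsBddAt_powerWitness (T : O →+* MvPowerSeries σ O) (e : ℕ) (P : ℕ → Ideal O) (m : ℕ) :
    F3hsBddAt p e T (PowerWitness.tilde p e P m) :=
  F3hsBddAt_of_subset_range_pow p T e _ fun i hi => by
    have hi' : i = -(((-i).toNat : ℕ) : ℤ) := by omega
    rw [hi']
    exact PowerWitness.tilde_neg_subset_range_pow e P m _ (by omega)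

end RhoLinear

/-! ## §3 ✓ SUMMAND-WISE: each summand of Eq. (36) re-based on `ρ^e(O)` is F3hs^{<p^e}-stable (res-adj-1's «✓c», at fixed `d`) -/

section Summand

variable {O : Type v} [CommRing O] (p : ℕ) [Fact p.Prime] [CharP O p] {σ : Type w}

/-- **F3hs^{<p^e} holds SUMMAND-WISE for SWρ**: for `|β| < p^e` and a summand index `d` with `0 ≤ dm + a` (automatic under Def
5.1's guard `|a| ≤ dm`), `D^{[β]}` maps `sandwichDDRho p e P m a d` (the `ρ^e(O)`-span of the values `∂f`, `ord_{ρ^e} ∂ ≤ dm+a`,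
`f ∈ ℘posi(E,dm)`) into `sandwichDDRho p e P m (a + |β|) d`: `D^{[β]}` is `ρ^e(O)`-linear (§2), so it suffices to treat a
generator, and `D^{[β]}(∂f) = (D^{[β]} ∘ ∂) f` with `ord_{ρ^e}(D^{[β]} ∘ ∂) ≤ |β| + dm + a` (`IsDiffOpLE.comp`). [folklore] -/
theorem hsComponent_mem_sandwichDDRho [DecidableEq σ] (T : O →+* MvPowerSeries σ O)
    (hT0 : ∀ b, MvPowerSeries.constantCoeff (T b) = b) (e : ℕ) {β : σ →₀ ℕ} (hβ : degree β < p ^ e)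
    (P : ℕ → Ideal O) (m : ℕ) {a d : ℤ} (had : 0 ≤ d * m + a) {x : O}
    (hx : x ∈ sandwichDDRho p e P m a d) :
    hsComponent T β x ∈ sandwichDDRho p e P m (a + degree β) d := by
  unfold sandwichDDRho at hx ⊢
  have hx' : hsComponentRhoₗ p T hT0 e β hβ x ∈
      (Submodule.span (↥(iterateFrobenius O p e).range)
        {x | ∃ D : O →ₗ[↥(iterateFrobenius O p e).range] O,
          IsDiffOpLE (↥(iterateFrobenius O p e).range) (d * m + a).toNat D ∧
            ∃ f ∈ S05NegativePart.pPosi P (d * m).toNat, D f = x}).map (hsComponentRhoₗ p T hT0 e β hβ) :=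
    Submodule.mem_map_of_mem hx
  rw [Submodule.map_span] at hx'
  refine Submodule.span_mono ?_ hx'
  rintro _ ⟨y, ⟨D, hD, f, hf, rfl⟩, rfl⟩
  refine ⟨hsComponentRhoₗ p T hT0 e β hβ ∘ₗ D, ?_, f, hf, rfl⟩
  have horder : (d * m + (a + (degree β : ℕ))).toNat = degree β + (d * m + a).toNat := by omega
  rw [horder]
  exact (isDiffOpLE_hsComponentRhoₗ p T hT0 e (degree β) β hβ le_rfl).comp hD

/-- **Family level, into the RELAXED target**: for `x ∈ ℘̃_swρ(E,−a) = ⨆_{d : |a| ≤ dm} sandwichDDRho … a d`, `D^{[β]} x` lies in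
`⨆_{d : |a| ≤ dm} sandwichDDRho … (a + |β|) d` — the summands of degree `−(a+|β|)` over the index range OF THE SOURCE degree. Def.
5.1's own piece `℘̃_swρ(E,−(a+|β|))` keeps only `d` with `|a + |β|| ≤ dm`; the difference is the boundary summands
`a ≤ dm < a + |β|`, and §4 shows they are NOT absorbed. [folklore] -/
theorem hsComponent_mem_iSup_sandwichDDRho [DecidableEq σ] (T : O →+* MvPowerSeries σ O)
    (hT0 : ∀ b, MvPowerSeries.constantCoeff (T b) = b) (e : ℕ) {β : σ →₀ ℕ} (hβ : degree β < p ^ e)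
    (P : ℕ → Ideal O) (m : ℕ) (a : ℤ) {x : O} (hx : x ∈ sandwichPTildeNegRho p e P m a) :
    hsComponent T β x ∈ ⨆ (d : ℤ) (_ : |a| ≤ d * m), sandwichDDRho p e P m (a + degree β) d := by
  unfold sandwichPTildeNegRho at hx
  have hx' : hsComponentRhoₗ p T hT0 e β hβ x ∈
      (⨆ (d : ℤ) (_ : |a| ≤ d * m), sandwichDDRho p e P m a d).map (hsComponentRhoₗ p T hT0 e β hβ) :=
    Submodule.mem_map_of_mem hx
  simp only [Submodule.map_iSup] at hx'
  have hle : (⨆ (d : ℤ) (_ : |a| ≤ d * m), (sandwichDDRho p e P m a d).map (hsComponentRhoₗ p T hT0 e β hβ)) ≤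
      ⨆ (d : ℤ) (_ : |a| ≤ d * m), sandwichDDRho p e P m (a + degree β) d := by
    refine iSup₂_mono fun d hd => ?_
    rintro _ ⟨y, hy, rfl⟩
    have had : 0 ≤ d * m + a := by
      have := abs_nonneg a
      have := neg_abs_le a
      omega
    exact hsComponent_mem_sandwichDDRho p T hT0 e hβ P m had hy
  exact hle hx'

end Summand

/-! ## §3b Data-level families on the sandwich carriers (the «tildeP» the cell is read on) and sandwich constants (for Part B) -/

section Families

variable {O : Type v} [CommRing O] (p : ℕ) [Fact p.Prime] [CharP O p]

/-- [OURS · model data] The ℤ-indexed data-level family of the SWρ MODULES in Def. 5.1's own indexation, ALL degrees: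
`i ↦ ℘̃_swρ(E,i) := sandwichPTildeNegRho p e P m (−i)` as additive subgroups (degree `i = −a`; for `i < 0` this is
`Campaign.sandwichPNegaRho p e P m |i|` definitionally) — the «tildeP» the cell `F3hsBddAt` is read on (same convention as
res-D-pv-040's F8⁻/F3⁻ cells «tilde P i := sandwichPTildeNeg p e P (p^e) (−i)»). NOT a statement of the manuscript. [folklore] -/
def sandwichRhoFamily (e : ℕ) (P : ℕ → Ideal O) (m : ℕ) : ℤ → AddSubgroup O :=
  fun i => (sandwichPTildeNegRho p e P m (-i)).toAddSubgroup

/-- Unfolding (by `Iff.rfl`). [folklore] -/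
theorem mem_sandwichRhoFamily_iff (e : ℕ) (P : ℕ → Ideal O) (m : ℕ) (i : ℤ) (x : O) :
    x ∈ sandwichRhoFamily p e P m i ↔ x ∈ sandwichPTildeNegRho p e P m (-i) :=
  Iff.rfl

/-- `℘posi(E,j) ⊆ ℘(E,j)` (row 008's `pPosi` is `⊥` at `j = 0` and `P j` otherwise). [folklore] -/
theorem pPosi_le (P : ℕ → Ideal O) (j : ℕ) : S05NegativePart.pPosi P j ≤ P j := by
  unfold S05NegativePart.pPosi
  split_ifs
  · exact bot_le
  · exact le_rfl

/-- **Sandwich constants**: the principal ideal `(c^{n·p^e}) = ρ^e(c^n)·O` is stable under EVERY `ρ^e(O)`-linear endomorphism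
`D` of `O` (`D(g·c^{np^e}) = c^{np^e}·D g`) — in particular under every sandwich operator of any order. [folklore] -/
theorem apply_mem_span_pow_mul_pow (e : ℕ) (D : O →ₗ[↥(iterateFrobenius O p e).range] O) (c : O) (n : ℕ)
    {f : O} (hf : f ∈ Ideal.span {c ^ (n * p ^ e)}) : D f ∈ Ideal.span {c ^ (n * p ^ e)} := by
  obtain ⟨g, rfl⟩ := Ideal.mem_span_singleton'.mp hf
  have hc : c ^ (n * p ^ e) = iterateFrobenius O p e (c ^ n) := by
    rw [iterateFrobenius_def, ← pow_mul]
  let r : ↥(iterateFrobenius O p e).range := ⟨c ^ (n * p ^ e), ⟨c ^ n, hc.symm⟩⟩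
  have hsmul : g * c ^ (n * p ^ e) = r • g := by rw [Subring.smul_def, smul_eq_mul, mul_comm]
  rw [hsmul, LinearMap.map_smul, Subring.smul_def, smul_eq_mul]
  change c ^ (n * p ^ e) * D g ∈ _
  exact Ideal.mul_mem_right _ _ (Ideal.mem_span_singleton_self _)

/-- [OURS · model data] The ℤ-indexed data-level family of the W1.2 sandwich IDEALS in Def. 5.1's indexation, all degrees:
`i ↦ ℘̃_sw(E,i) := sandwichPTildeNeg p e P m (−i)` as additive subgroups (for `i < 0` this is `Campaign.sandwichPNega p e P m |i|`
definitionally). NOT a statement of the manuscript. [folklore] -/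
def sandwichFamily (e : ℕ) (P : ℕ → Ideal O) (m : ℕ) : ℤ → AddSubgroup O :=
  fun i => (sandwichPTildeNeg p e P m (-i)).toAddSubgroup

/-- Unfolding (by `Iff.rfl`). [folklore] -/
theorem mem_sandwichFamily_iff (e : ℕ) (P : ℕ → Ideal O) (m : ℕ) (i : ℤ) (x : O) :
    x ∈ sandwichFamily p e P m i ↔ x ∈ sandwichPTildeNeg p e P m (-i) :=
  Iff.rfl

end Families

end Summit.ResolutionOfSingularities.ResolutionOfSingularities.Theorems.Campaign.PnegaObligation

/-! ## §6 Over the checklist of record: F3hs^{<p^e} is FORCED ✓ on inhabitants of `PnegaInterfaceV3` (it discriminates only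
data-level candidates such as SW / SWρ, which are not inhabitants — E-H, `PnegaInterfaceV3.mul_mem_neg`) -/

namespace Summit.ResolutionOfSingularities.ResolutionOfSingularities.Theorems.Campaign.PnegaInterfaceV3

open Literature.AlgebraicGeometry.Resolution

universe u v w

variable {K : Type u} [CommRing K] {p : ℕ} {prov : PnegaProvenance.{u, v} K}

/-- **Every inhabitant meets F3hs^{<p^e'}** at every guarded `P`, for every Hasse–Schmidt homomorphism mapping `K` to constants with
`D^{[0]} = id` and every `p', e'` (from `PnegaInterfaceV3.f3hsAt`, i.e. from the field `diff_mem_neg`). [folklore] -/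
theorem f3hsBddAt (I : PnegaInterfaceV3 K p prov) {B : Type v} [CommRing B] [Algebra K B] {σ : Type w} [DecidableEq σ]
    (T : B →+* MvPowerSeries σ B) (hTK : ∀ r : K, T (algebraMap K B r) = MvPowerSeries.C (algebraMap K B r))
    (hT0 : ∀ b, MvPowerSeries.constantCoeff (T b) = b) (P : ℕ → Ideal B) (hP : IsCharFiltration K P) (p' e' : ℕ) :
    PnegaObligation.F3hsBddAt p' e' T (I.tilde P) :=
  PnegaObligation.F3hsBddAt_of_F3hsAt p' e' T (I.tilde P) (I.f3hsAt T hTK hT0 P hP)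

end Summit.ResolutionOfSingularities.ResolutionOfSingularities.Theorems.Campaign.PnegaInterfaceV3

end
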